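import Summits.BirchSwinnertonDyer.BirchSwinnertonDyer.Theorems.KatoDescentPotSupersingularWildUpperUnitTwistRoadAtP
import Summits.BirchSwinnertonDyer.BirchSwinnertonDyer.Theorems.KatoDescentPotSupersingularWildJetchevBoundAtPTwoSplit
import HarnessLib

/-!
# Route `KatoDescentPotSupersingular` (rung K9, sub-rung B5 = O6 wild `p = 3`, cell `bsd-potss`): the ♯ₚ UNIT-TWIST road in RECORD-INPUT form
# over the FOUR NAMED FACTS (seat `bsd-potss-k9-c4` g17; a certificate shape — nothing booked, no item closed, BSD is not proved by any of this)

WHY. `WildUpperUnitTwistRoadAtP.missingUpperBoundAt_sharpAtP_of_datum_of_unitTwist` (p610552, this seat) takes the `q = p` two-split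
Jetchev–Kolyvagin bound as a displayed SCHEMA `hJp` (the body of crux 21422 `WildJetchevBoundAtPTwoSplit`, a 15-line binder). k9-c4 g11's
`JetchevIrreducibleSwapAtP.boundAtP_twoSplit_of_structureIrred_of_namedFacts` (p564034, file `…WildJetchevBoundAtPTwoSplit`) PROVES that
schema from four named Literature facts — Matar–Nekovář 2019 Thm 0.7 (`hS1`), Gross 1991 Prop 3.7 (2) (`h37`), Poitou–Tate for Selmer
structures (`hPT`), Gross–Zagier III (3.1) image-free (`hF1`) — plus Kolyvagin (`hKo`) and modularity as newforms (`hnf`). This file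
substitutes that proof — exactly as k8t-c4 g14's `TameUpperUnitTwistRecords.missingUpperBoundAt_sharp_of_namedFacts_of_datum_of_unitTwist`
(p598182) does for the `q ≠ p` reading — so a ♯ₚ record can display five SHORT named-fact binders (by name, exactly the held aliases
23034–23037 of the K9 route + modularity as newforms) instead of the schema: `missingUpperBoundAt_sharpAtP_of_namedFacts_of_datum_of_unitTwist`.
(Import note: `…WildJetchevBoundAtPTwoSplit` has the K9 route file in its import cone, as p598182's `…JetchevIrreducibleReadingTwoSplit`
has the KT/K9 route files in its cone; the theorem used takes no route declaration as a hypothesis.)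

HONEST FRAMING: CONDITIONAL on every displayed hypothesis (the four named facts are cite-level, HELD items 23034–23037; Gross–Zagier,
Kolyvagin, GZK, modularity are published inputs); the twist's analytic rank and `#Ш_an` are NUMERICAL data displayed by the records;
per-ROW statement (never a ∀-item); closes nothing (19189 / 19197 / 21422 stay OPEN); 0 definitions, 0 named facts minted, 0 `sorry`.

References: [Jetchev2008] Conj. 1.3, Thm. 1.4, Cor. 1.5, Rem. 6.2; [MatarNekovar2019] Thm. 0.7, §0.11; [GrossLMS1991] Prop. 3.7 (2);
[GrossZagier1986] I.6.3, III (3.1); [MilneADT2006] I Thm. 4.10; [KolyvaginEulerSystems1990] Thm. A; [Miller2011LMS] Def. 1.1.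
-/

set_option autoImplicit false
-- the Theorems directory repeats the summit name (sibling precedent `KatoDescentPotSupersingularAssembly.lean`)
set_option linter.dupNamespace false

noncomputable section

open scoped Classical NumberField

namespace Summit.BirchSwinnertonDyer.BirchSwinnertonDyer.Theorems.WildUpperUnitTwistRoadAtP

open WeierstrassCurve NumberField Literature.NumberTheory.EllipticCurves
  Literature.NumberTheory.EllipticCurves.ModularForms
  Literature.NumberTheory.EllipticCurves.Rank1Residual
  Literature.NumberTheory.EllipticCurves.Rank1Residual.Typed
  Literature.NumberTheory.GaloisCohomology
  Summit.BirchSwinnertonDyer.Rank1Residual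
  Summit.BirchSwinnertonDyer.Rank1Residual.Additive
  Summit.BirchSwinnertonDyer.BirchSwinnertonDyer.Theorems

/-- **♯ₚ UNIT-TWIST ROAD, record-input form, over the FOUR NAMED FACTS.** As
`missingUpperBoundAt_sharpAtP_of_datum_of_unitTwist` (p610552 §2), with the schema `hJp` (the `q = p` two-split Jetchev–Kolyvagin bound = crux
21422's body) DERIVED from Matar–Nekovář 2019 Thm 0.7 (`hS1`), Gross 1991 Prop 3.7 (2) (`h37`), Poitou–Tate for Selmer structures (`hPT`),
Gross–Zagier III (3.1) image-free (`hF1`), Kolyvagin (`hKo`) and modularity as newforms (`hnf`) by k9-c4 g11's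
`JetchevIrreducibleSwapAtP.boundAtP_twoSplit_of_structureIrred_of_namedFacts`. Row inputs: conductor `N` (`hN`), `r_an(W) = 0`, `Addv W p`,
`ord_p j ≥ 0`, non-CM, `W[p]` irreducible with `p`-adic tower NOT onto, a lattice-OPTIMAL datum `D` of level `N` with `p ∤ c(D)`, the single
carrier at `p` (`hcarrier : ord_p ∏c_ℓ ≤ ord_p c_p`), the Heegner field (`hK`, `hHN`, `d_K ≡ 1 (8)`, `d_K < −4`), the minimal twist model with
`Cd • W^{(d_K)} = Wd`, and the displayed numerics `r_an(Wd) = 1`, `#Ш_an(Wd) = qd`, `ord_p qd ≤ 0`. CONDITIONAL on the displayed hypotheses; per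
row; closes nothing. [cite: Jetchev2008, Conj. 1.3, Cor. 1.5 (p. 812), Rem. 6.2] [cite: MatarNekovar2019, Thm. 0.7 (p. 456), §0.11 (p. 457)]
[cite: GrossLMS1991, Prop. 3.7 (2)] [cite: GrossZagier1986, Thm. I.6.3, III (3.1)] [cite: MilneADT2006, I Thm. 4.10] [cite: Miller2011LMS, Def. 1.1] -/
theorem missingUpperBoundAt_sharpAtP_of_namedFacts_of_datum_of_unitTwist
    (hGZ : ∀ (N : ℕ) [NeZero N] (W : WeierstrassCurve ℚ) (K : Type) [Field K] [NumberField K],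
      gross_zagier N W K)
    (hKo : ∀ (N : ℕ) [NeZero N] (W : WeierstrassCurve ℚ) (K : Type) [Field K] [NumberField K],
      kolyvagin N W K)
    (hGZK : rank_eq_analyticRank_of_analyticRank_le_one) (hmod : hasEntireLFunction_rat)
    (hS1 : MatarNekovar2019.thm07_padicValNat_card_sha_primary_add_le_of_globalDivisibility_of_irreducible)
    (h37 : GrossLMS1991.prop37_2_frobeniusCongruence)
    (hPT : ∀ (K : Type) [Field K] [NumberField K], poitouTate_selmerStructure_duality_conj K)
    (hF1 : Gross1991_heegnerPoint_sub_ratTorsion_mem_E0_imageFree) (hnf : exists_isNewformOf)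
    (W : WeierstrassCurve ℚ) [W.IsElliptic] [W.IsGloballyMinimal] (p : ℕ) [Fact p.Prime] (hp2 : p ≠ 2)
    {N : ℕ} [NeZero N] (hN : W.conductorNorm ℤ = N)
    (hr : W.analyticRank = 0) (hadd : Addv W p) (hj : 0 ≤ padicValRat p W.j) (hcm : ¬ W.HasCM)
    (hirr : W.HasIrreducibleModPGaloisRep p) (hns : ¬ (∀ n : ℕ, W.HasSurjectiveModNGaloisRep (p ^ n : ℕ)))
    (D : ModularParametrizationData W N)
    (hopt : ∀ z ∈ D.L.lattice, ∃ w ∈ periodLattice D.f, z = (D.c : ℂ) * w) (hc : ¬ (p : ℤ) ∣ D.c)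
    (hcarrier : padicValNat p W.tamagawaProduct ≤
      padicValNat p ((W.baseChange ℚ_[p]).localTamagawaNumber ℤ_[p]))
    (K : Type) [Field K] [NumberField K] (hK : IsImaginaryQuadratic K) (hHN : SatisfiesHeegnerHypothesis N K)
    (h8 : NumberField.discr K % 8 = 1) (hd4 : NumberField.discr K < -4)
    (Wd : WeierstrassCurve ℚ) [Wd.IsElliptic] [Wd.IsGloballyMinimal] (Cd : VariableChange ℚ)
    (hWd : Cd • W.quadraticTwist (NumberField.discr K : ℚ) = Wd) (hrd : Wd.analyticRank = 1)
    {qd : ℚ} (hqd : shaAn Wd = (qd : ℂ)) (hvd : padicValRat p qd ≤ 0) :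
    MissingUpperBoundAt W p :=
  missingUpperBoundAt_sharpAtP_of_datum_of_unitTwist hGZ hKo hGZK hmod
    (JetchevIrreducibleSwapAtP.boundAtP_twoSplit_of_structureIrred_of_namedFacts hS1 h37 hPT hF1 hKo hnf) W p hp2 hN hr hadd hj
    hcm hirr hns D hopt hc hcarrier K hK hHN h8 hd4 Wd Cd hWd hrd hqd hvd

end Summit.BirchSwinnertonDyer.BirchSwinnertonDyer.Theorems.WildUpperUnitTwistRoadAtP

end
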